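import Literature.Geometry.Kaehler.ComplexTorusAbelianSurfacePicardNumberThreeHodgeGroup
import Literature.Geometry.Kaehler.ComplexTorusAbelianSurfaceNonSimpleStablyNondegenerate
import Literature.Geometry.Kaehler.ComplexTorusHodgeLieAlgebraIsogeny
import Literature.Geometry.Kaehler.ComplexTorusHodgeLieAlgebraProductsPowers
import Literature.Geometry.Kaehler.ComplexTorusEllipticCurveHodgeLieAlgebra
import Literature.Geometry.Kaehler.ComplexTorusHomRankEquality
import Literature.Geometry.Kaehler.ComplexTorusProductPowerIsomorphisms
import HarnessLib

/-!
# EVERY abelian SURFACE with PICARD NUMBER `ρ(X) = 3` has `dim Hg(X) = dim_ℝ 𝔥𝔤_ℝ = 3`, `(dim 𝔨, dim 𝔭) = (1, 2)`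
# and `ℬ•(Xⁿ) = 𝒟•(Xⁿ)` for every `n` — Sato–Tate type **E** (`End(A)_ℝ = M₂(ℝ)` ↔ `SU(2)`) read on `ρ`:
# the non-simple half `X ∼ E × E`, `E` without complex multiplication, and the assembly with g48-#5

Layer `Literature/Geometry/Kaehler`, namespace `Literature.Geometry.Kaehler.ComplexTorus`; lane `lit-hodgefound`
(Track 2 foundations library), Layer A4; prover seat `lit-hodgefound-p17` (generation 48), self-proposed row g48-#6,
sequel BY NAME of g48-#5 (`ComplexTorusAbelianSurfacePicardNumberThreeHodgeGroup`: a SIMPLE abelian surface with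
`ρ(X) = 3` has quaternion multiplication and `dim_ℝ 𝔥𝔤_ℝ = 3`), of `ComplexTorusAbelianSurfaceNonSimple` (p17: a
non-simple abelian surface is `∼ E₁ × E₂`, with `ρ = 2` if `E₁ ≁ E₂` and `ρ = 2 + dim_ℚ End_ℚ(E₁)` if `E₁ ∼ E₂`), of
the isogeny invariance `IsIsogenous.finrank_hodgeGroupLie_eq`, of `finrank_hodgeGroupLie_pow` (`𝔥𝔤(Xᴺ) ≅ 𝔥𝔤(X)`) and
of `ComplexTorusEllipticCurveHodgeLieAlgebra` (`dim 𝔥𝔤_ℝ(E_τ) = 3` for `E_τ` without complex multiplication).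

For a NON-SIMPLE abelian surface, `ρ(X) = 3` forces `X ∼ E_τ × E_τ ≅ E_τ²` with `End(E_τ) = ℤ` (§1), hence
`dim_ℝ 𝔥𝔤_ℝ(X) = dim_ℝ 𝔥𝔤_ℝ(E_τ²) = dim_ℝ 𝔥𝔤_ℝ(E_τ) = 3` (`𝔥𝔤_ℝ = Δ𝔰𝔩₂(ℝ)`); with g48-#5 this gives the theorem
of the title for EVERY abelian surface (§2): the two cases of Fité–Kedlaya–Rotger–Sutherland's absolute type **E**
(«`A_K` is isogenous to the square of an elliptic curve without CM, or `A_K` is simple and `End(A_K)` is an order in a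
division quaternion algebra over `ℚ`») are exactly the abelian surfaces with `ρ = 3`, and their connected Sato–Tate
group is `SU(2)`, the compact form of `Hg(X)_ℝ ≅ SL₂(ℝ)`.

THEOREMS ONLY (no definition, no instance, no notation, no named fact; D-0026, net debt 0); nothing restated.

## Sources, VERBATIM (held copies; `p0NNN Lnn` = chunk file and line of the materialised text)

* K. Hulek, R. Laface, *On the Picard numbers of abelian varieties* (2019), held `paper:arxiv-1703.05882`, §1 (p0003)
  «Picard numbers from 2 to 4 can be realized by taking a product `E₁ × E₂` of two elliptic curves. If the two elliptic
  curves are not isogenous, then `ρ = 2`, if they are isogenous but they do not have complex multiplication, then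
  `ρ = 3`, while if they also have complex multiplication `ρ = 4`»; §3 (p0011 L39) «the Picard number is `ρ = 3e` for
  type II».
* F. Fité, K. S. Kedlaya, V. Rotger, A. V. Sutherland, *Sato–Tate distributions and Galois endomorphism modules in
  genus 2* (2012), held `paper:arxiv-1110.6638`, §4.2 (p0014 L65–L70) «(**E**) `M₂(ℝ)`, which occurs when either `A_K`
  is isogenous to the square of an elliptic curve without CM, or `A_K` is simple and `End(A_K)` is an order in a division
  quaternion algebra over `ℚ`», (p0014 L78–L82) «The six absolute types are in one-to-one correspondence with the six
  connected Lie subgroups of `USp(4)` appearing in Lemma […] **E**: `SU(2)`»; §3.2 Lemma 3.7.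
* B. Moonen, Yu. G. Zarhin, *Hodge classes on abelian varieties of low dimension* (1999), held `paper:arxiv-math_9901113`
  (no statement numbers in the held TeX), §1 (powers: `Hg(Xⁿ) ≅ Hg(X)` acting diagonally), (0.2)(4) (isogeny
  invariance), §2 (2.1) `g = 1` (p0005 L43–L44) «Type I(1): `X` is an elliptic curve with `End⁰(X) = ℚ`. Then
  `Hg(X) = Sp(V,φ) ≅ SL_{2,ℚ}`», §3 Corollary (p0007 L80–L84: «every product of elliptic curves satisfies condition
  (D)»), §3 (p0008 L107–L111).
* H. Lange, *Abelian Varieties over the Complex Numbers* (2023), §5.1.5 Exercise (2)(a) (a non-simple abelian surface is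
  isogenous to a product of elliptic curves) and §2.6.1 Proposition (table).

## Contents

* §1 NON-SIMPLE, `ρ = 3`: **`IsRiemannForm.exists_isIsogenous_powPeriod_ellipticPeriod_of_not_isSimple_of_finrank_neronSeveriGroup_eq_three`**
  (`X ∼ E_τ²` with `End(E_τ) = ℤ`), **`IsRiemannForm.finrank_hodgeGroupLie_eq_three_of_not_isSimple_of_finrank_neronSeveriGroup_eq_three`**
  (`dim_ℝ 𝔥𝔤_ℝ = 3`).
* §2 EVERY ABELIAN SURFACE WITH `ρ = 3`: **`IsRiemannForm.finrank_hodgeGroupLie_eq_three_of_finrank_neronSeveriGroup_eq_three`**,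
  the `IsAbelianVariety` forms `…finrank_hodgeGroupLie_eq_three…`, `…finrank_hodgeGroupComplexLie_eq_three…`,
  `…zdim_hodgeGroupC_eq_three…` (`dim Hg(X) = 3`), `…finrank_hodgeIsotropyLie_eq_one…` (`(dim 𝔨, dim 𝔭) = (1, 2)`),
  and **`IsAbelianVariety.forall_divisorClasses_powPeriod_eq_hodgeClasses_of_finrank_neronSeveriGroup_eq_three`**
  (`ℬ•(Xⁿ) = 𝒟•(Xⁿ)` for every `n`).
-/

noncomputable section

open scoped Matrix
open Module Matrix NormedSpace NumberField
open Literature.NumberTheory.Automorphic (IsZConnected)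

namespace Literature.Geometry.Kaehler

namespace ComplexTorus

/-! ## §1 A non-simple abelian surface with `ρ(X) = 3` is isogenous to `E_τ²`, `E_τ` without complex multiplication -/

section NonSimple

variable {κ : Type} [Fintype κ] [DecidableEq κ] {E : Type} [NormedAddCommGroup E] [NormedSpace ℂ E]
  [FiniteDimensional ℂ E] {Ψ : (κ → ℝ) ≃L[ℝ] E} {η : E [⋀^Fin 2]→L[ℝ] ℝ}

/-- **A NON-SIMPLE abelian surface with `ρ(X) = 3` is isogenous to the square `E_τ²` of an elliptic curve WITHOUT
complex multiplication**: `X ∼ E₁ × E₂` (Poincaré), `E₁ ≁ E₂` would give `ρ = 2`, so `E₁ ∼ E₂` and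
`ρ = 2 + dim_ℚ End_ℚ(E₁)` gives `End_ℚ(E₁) = ℚ`; with `E₁ ≅ E_τ`: `X ∼ E_τ × E_τ ≅ E_τ²`, `End(E_τ) = ℤ`.
(«if they are isogenous but they do not have complex multiplication, then `ρ = 3`», read backwards.)
[cite: HulekLaface2019PicardNumbersAV, §1 («Picard numbers from 2 to 4 … if they are isogenous but they do not have complex multiplication, then `ρ = 3`»)]
[cite: Lange2023AbelianVarietiesComplex, §5.1.5 Exercise (2)(a)] [cite: FiteEtAl2012, §4.2 (type **E**: «isogenous to the square of an elliptic curve without CM»)] -/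
theorem IsRiemannForm.exists_isIsogenous_powPeriod_ellipticPeriod_of_not_isSimple_of_finrank_neronSeveriGroup_eq_three
    (hη : IsRiemannForm Ψ η) (hg : finrank ℂ E = 2) (hX : ¬ IsSimple Ψ) (hρ : finrank ℤ (neronSeveriGroup Ψ) = 3) :
    ∃ (τ : ℂ) (hτ : τ.im ≠ 0), ellipticEnd hτ = ⊥ ∧ IsIsogenous Ψ (powPeriod (ellipticPeriod hτ) 2) := by
  obtain ⟨V, hV, hVc, hW, hWc, h1, h2, hiso, -⟩ := hη.exists_isIsogenous_prod_elliptic_of_not_isSimple hg hX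
  have hY : Fintype.card (Fin (subRank V)) = 2 := by rw [Fintype.card_fin, h1]
  have hZ : Fintype.card (Fin (subRank (orthSubspace Ψ η V))) = 2 := by rw [Fintype.card_fin, h2]
  have hYa : IsAbelianVariety (subtorusPeriod Ψ V hV hVc) := ⟨_, isRiemannForm_restrict Ψ hη hV hVc⟩
  -- the two factors are isogenous (else `ρ = 2`)
  have hYZ : IsIsogenous (subtorusPeriod Ψ V hV hVc) (subtorusPeriod Ψ (orthSubspace Ψ η V) hW hWc) := by
    by_contra hni
    have h2' := hiso.finrank_neronSeveriGroup_eq_two_of_not_isIsogenous hY hZ hYa hni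
    omega
  -- the first factor has no complex multiplication (`ρ = 2 + dim_ℚ End_ℚ(E₁)`)
  have hdY : finrank ℚ (endAlgRat (subtorusPeriod Ψ V hV hVc)) = 1 := by
    have h := hiso.finrank_neronSeveriGroup_eq_two_add_of_isIsogenous hY hZ hYa hYZ
    omega
  -- `E₁ ≅ E_τ`
  have hd₁ : finrank ℂ (cxSpan Ψ V) = 1 := by
    have h := subRank_eq_two_mul_finrank Ψ hV hVc
    omega
  obtain ⟨τ, hτ, e⟩ := exists_isIsomorphic_ellipticPeriod (subtorusPeriod Ψ V hV hVc) hd₁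
  refine ⟨τ, hτ, ?_, ?_⟩
  · by_contra hcm
    have h2τ := (finrank_endAlgRat_ellipticPeriod_eq_two_iff hτ).2 hcm
    rw [← e.isIsogenous.finrank_endAlgRat_eq, hdY] at h2τ
    omega
  · -- `X ∼ E₁ × E₂ ∼ E_τ × E_τ ≅ E_τ¹ × E_τ¹ ≅ E_τ²`
    have h3 : IsIsogenous (prodPeriod (subtorusPeriod Ψ V hV hVc) (subtorusPeriod Ψ (orthSubspace Ψ η V) hW hWc))
        (prodPeriod (ellipticPeriod hτ) (ellipticPeriod hτ)) :=
      IsIsogenous.prod e.isIsogenous (IsIsogenous.trans _ _ _ (IsIsogenous.symm _ _ hYZ) e.isIsogenous)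
    have h4 : IsIsomorphic (prodPeriod (ellipticPeriod hτ) (ellipticPeriod hτ)) (powPeriod (ellipticPeriod hτ) 2) :=
      ((isIsomorphic_powPeriod_one (ellipticPeriod hτ)).prod (isIsomorphic_powPeriod_one (ellipticPeriod hτ))).trans
        (isIsomorphic_prodPeriod_powPeriod_add (ellipticPeriod hτ) 1 1)
    exact IsIsogenous.trans _ _ _ hiso (IsIsogenous.trans _ _ _ h3 h4.isIsogenous)

/-- **`dim_ℝ 𝔥𝔤_ℝ = 3` for a NON-SIMPLE abelian surface with `ρ(X) = 3`** (`X ∼ E_τ²`, `𝔥𝔤_ℝ(E_τ²) ≅ 𝔥𝔤_ℝ(E_τ) =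
𝔰𝔩₂(ℝ)` for `E_τ` without complex multiplication; «`Hg(X) = Sp(V,φ) ≅ SL_{2,ℚ}`» for `g = 1`, Type I(1), and
`Hg(Xⁿ) ≅ Hg(X)`). [cite: MoonenZarhin1999LowDim, §2 (2.1) `g = 1` («Type I(1) … `Hg(X) = Sp(V,φ) ≅ SL_{2,ℚ}`»), §1 (powers) and (0.2)(4) (isogeny)]
[cite: FiteEtAl2012, §4.2 (type **E** ↔ `SU(2)`)] [cite: HulekLaface2019PicardNumbersAV, §1] -/
theorem IsRiemannForm.finrank_hodgeGroupLie_eq_three_of_not_isSimple_of_finrank_neronSeveriGroup_eq_three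
    (hη : IsRiemannForm Ψ η) (hg : finrank ℂ E = 2) (hX : ¬ IsSimple Ψ) (hρ : finrank ℤ (neronSeveriGroup Ψ) = 3) :
    finrank ℝ (hodgeGroupLie Ψ) = 3 := by
  obtain ⟨τ, hτ, hE, hiso⟩ :=
    hη.exists_isIsogenous_powPeriod_ellipticPeriod_of_not_isSimple_of_finrank_neronSeveriGroup_eq_three hg hX hρ
  rw [hiso.finrank_hodgeGroupLie_eq, finrank_hodgeGroupLie_pow (ellipticPeriod hτ) two_pos,
    finrank_hodgeGroupLie_ellipticPeriod_of_eq_bot hτ hE]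

end NonSimple

/-! ## §2 Every abelian surface with `ρ(X) = 3` -/

section Every

variable {κ : Type} [Fintype κ] [DecidableEq κ] {E : Type} [NormedAddCommGroup E] [NormedSpace ℂ E]
  [FiniteDimensional ℂ E] {Ψ : (κ → ℝ) ≃L[ℝ] E} {η : E [⋀^Fin 2]→L[ℝ] ℝ}

/-- **`dim_ℝ 𝔥𝔤_ℝ = 3` FOR EVERY POLARISED ABELIAN SURFACE WITH `ρ(X) = 3`** — simple: quaternion multiplication
(g48-#5); non-simple: `X ∼ E_τ²` with `End(E_τ) = ℤ` (§1).  These are the abelian surfaces of absolute type **E**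
(`End_ℝ = M₂(ℝ)`), with connected Sato–Tate group `SU(2)`, the compact form of `Hg(X)_ℝ ≅ SL₂(ℝ)`.
[cite: FiteEtAl2012, §4.2 (type **E**: «isogenous to the square of an elliptic curve without CM, or … an order in a division quaternion algebra over `ℚ`» ↔ `SU(2)`) and §3.2 Lemma 3.7]
[cite: HulekLaface2019PicardNumbersAV, §1 and §3 («`ρ = 3e` for type II»)] [cite: MoonenZarhin1999LowDim, §2 (2.1), (2.2)] -/
theorem IsRiemannForm.finrank_hodgeGroupLie_eq_three_of_finrank_neronSeveriGroup_eq_three (hη : IsRiemannForm Ψ η)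
    (hg : finrank ℂ E = 2) (hρ : finrank ℤ (neronSeveriGroup Ψ) = 3) : finrank ℝ (hodgeGroupLie Ψ) = 3 := by
  haveI : Nonempty κ := Fintype.card_pos_iff.1 (by rw [card_eq_two_mul_finrank Ψ, hg]; norm_num)
  by_cases hX : IsSimple Ψ
  · exact IsAbelianVariety.finrank_hodgeGroupLie_eq_three_of_isSimple_of_finrank_neronSeveriGroup_eq_three ⟨η, hη⟩
      hX hg hρ
  · exact hη.finrank_hodgeGroupLie_eq_three_of_not_isSimple_of_finrank_neronSeveriGroup_eq_three hg hX hρ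

/-- `∃`-polarisation form: **every abelian surface with `ρ(X) = 3` has `dim_ℝ 𝔥𝔤_ℝ = 3`.**
[cite: FiteEtAl2012, §4.2 (type **E** ↔ `SU(2)`) and §3.2 Lemma 3.7] [cite: HulekLaface2019PicardNumbersAV, §1 and §3] -/
theorem IsAbelianVariety.finrank_hodgeGroupLie_eq_three_of_finrank_neronSeveriGroup_eq_three (hA : IsAbelianVariety Ψ)
    (hg : finrank ℂ E = 2) (hρ : finrank ℤ (neronSeveriGroup Ψ) = 3) : finrank ℝ (hodgeGroupLie Ψ) = 3 := by
  obtain ⟨η, hη⟩ := hA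
  exact hη.finrank_hodgeGroupLie_eq_three_of_finrank_neronSeveriGroup_eq_three hg hρ

/-- **`dim_ℂ 𝔤 = 3`** (`𝔤 = Lie Hg(X)(ℂ) ≅ 𝔰𝔩₂(ℂ)`) for every abelian surface with `ρ(X) = 3`.
[cite: FiteEtAl2012, §4.2 (type **E** ↔ `SU(2)`)] [cite: MoonenZarhin1999LowDim, §2 (2.1), (2.2)] -/
theorem IsAbelianVariety.finrank_hodgeGroupComplexLie_eq_three_of_finrank_neronSeveriGroup_eq_three
    (hA : IsAbelianVariety Ψ) (hg : finrank ℂ E = 2) (hρ : finrank ℤ (neronSeveriGroup Ψ) = 3) :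
    finrank ℂ (hodgeGroupComplexLie Ψ) = 3 := by
  rw [finrank_hodgeGroupComplexLie_eq_finrank_hodgeGroupLie Ψ]
  exact hA.finrank_hodgeGroupLie_eq_three_of_finrank_neronSeveriGroup_eq_three hg hρ

/-- **`dim Hg(X) = 3`** (the trunk's `zdim` of the connected algebraic group `Hg(X)(ℂ) ≤ GL(V_ℂ)`) for every abelian
surface with `ρ(X) = 3`. [cite: FiteEtAl2012, §4.2 (type **E** ↔ `SU(2)`)] [cite: GoodmanWallachGTM255, §1.4.4 Thm. 1.4.10] -/
theorem IsAbelianVariety.zdim_hodgeGroupC_eq_three_of_finrank_neronSeveriGroup_eq_three (hA : IsAbelianVariety Ψ)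
    (hg : finrank ℂ E = 2) (hρ : finrank ℤ (neronSeveriGroup Ψ) = 3) :
    (isZConnected_map_toGL_hodgeGroupC Ψ).zdim = 3 :=
  (zdim_hodgeGroupC_eq_iff_finrank_hodgeGroupLie_eq Ψ).2
    (hA.finrank_hodgeGroupLie_eq_three_of_finrank_neronSeveriGroup_eq_three hg hρ)

/-- **`(dim 𝔨, dim 𝔭) = (1, 2)`** for every abelian surface with `ρ(X) = 3` (`𝔥𝔤_ℝ ≅ 𝔰𝔩₂(ℝ) = 𝔰𝔬(2) ⊕ 𝔭`; the
`SU(2)` entry of the six types). [cite: FiteEtAl2012, §4.2 (type **E** ↔ `SU(2)`) and §3.2 Lemma 3.7] -/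
theorem IsAbelianVariety.finrank_hodgeIsotropyLie_eq_one_of_finrank_neronSeveriGroup_eq_three (hA : IsAbelianVariety Ψ)
    (hg : finrank ℂ E = 2) (hρ : finrank ℤ (neronSeveriGroup Ψ) = 3) :
    finrank ℝ (hodgeIsotropyLie Ψ) = 1 ∧ finrank ℝ (hodgeCartanP Ψ) = 2 := by
  obtain ⟨η, hη⟩ := hA
  exact (hη.finrank_hodgeGroupLie_eq_three_iff_of_finrank_eq_two hg).1
    (hη.finrank_hodgeGroupLie_eq_three_of_finrank_neronSeveriGroup_eq_three hg hρ)

/-- **EVERY ABELIAN SURFACE WITH `ρ(X) = 3` IS STABLY NONDEGENERATE: `ℬ•(Xⁿ) = 𝒟•(Xⁿ)` for every `n`** (simple: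
quaternion multiplication, g48-#5; non-simple: a product of elliptic curves up to isogeny, g48-#3).
[cite: MoonenZarhin1999LowDim, §3 (p0008 L107–L111: «for every complex abelian variety `X` of dimension `≤ 3` … condition (D) … is satisfied») and §3 Corollary (p0007 L80–L84)]
[cite: HulekLaface2019PicardNumbersAV, §1 and §3] -/
theorem IsAbelianVariety.forall_divisorClasses_powPeriod_eq_hodgeClasses_of_finrank_neronSeveriGroup_eq_three
    (hA : IsAbelianVariety Ψ) (hg : finrank ℂ E = 2) (hρ : finrank ℤ (neronSeveriGroup Ψ) = 3) :
    ∀ k p : ℕ, divisorClasses (powPeriod Ψ k) p = hodgeClasses (powPeriod Ψ k) p := by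
  haveI : Nonempty κ := Fintype.card_pos_iff.1 (by rw [card_eq_two_mul_finrank Ψ, hg]; norm_num)
  by_cases hX : IsSimple Ψ
  · exact hA.forall_divisorClasses_powPeriod_eq_hodgeClasses_of_isSimple_of_finrank_neronSeveriGroup_eq_three hX hg hρ
  · exact hA.forall_divisorClasses_powPeriod_eq_hodgeClasses_of_not_isSimple_of_finrank_eq_two hg hX

end Every

end ComplexTorus

end Literature.Geometry.Kaehler
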